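import Literature.AlgebraicGeometry.Morphisms.CechH1
import Mathlib.AlgebraicGeometry.Morphisms.Flat
import HarnessLib

/-!
# Sections of a base change along `Spec B → Spec A`, `A → B` surjective: the kernel of restriction

Let `f : X → Spec A` be a scheme over a ring `A`, `φ : A → B` a SURJECTIVE ring homomorphism with
kernel `K`, and
```
  Y ──i──▶ X
  │t        │f
  ▼        ▼
Spec B ──▶ Spec A
```
a cartesian square (`IsPullback i t f (Spec φ)`; e.g. the thickenings `X ⊗_A A/Iⁿ → X` of the tree's
`Morphisms/FormalFunctions.lean`, or the transition maps `X ⊗ A/Iᵐ → X ⊗ A/Iⁿ` between them, which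
are cartesian over `Spec A/Iᵐ → Spec A/Iⁿ`). Then `i` is a closed immersion, and for an AFFINE open
`W ⊆ X` the restriction `i♯_W : Γ(X, W) → Γ(Y, i⁻¹W)` has kernel exactly `K · Γ(X, W)`:

* `app_algebraMap_eq_zero_of_mem_ker` — functions coming from `K` die on `Y` (any open `W`; only the
  commutativity of the square is used);
* `mem_map_ker_of_app_eq_zero` — conversely a function on an affine `W` dying on `i⁻¹W` lies in
  `K · Γ(X, W)`: `Γ(Y, i⁻¹W)` is the pushout `Γ(X, W) ⊗_A B` (Mathlib
  `isIso_pushoutSection_of_isAffineOpen`, affine base change of sections), which maps to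
  `Γ(X, W) / K Γ(X, W)` compatibly (the map `B → Γ(X, W)/KΓ(X, W)` exists because `φ` is surjective
  with kernel `K`);
* `exists_eq_smul_of_app_eq_zero` — the principal case `K = (π)`: such a function is `π · c`.

This generalises (same proof) `Morphisms/FormalFunctionsCechProofs.mem_map_of_app_ι_eq_zero`, the case
`B = A/Iⁿ⁺¹` of the infinitesimal neighbourhoods themselves, to arbitrary cartesian squares over a
surjection — the form needed for the transition immersions of a tower of thickenings
(`Motives/GrothendieckExistenceWitt`: `X ⊗ W/pᵐ → X ⊗ W/pⁿ`). Everything is proved; no named facts.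

## References

* The Stacks Project, Tag 02KG (base change of sections over affines) and Tag 01QN/08KS (closed
  immersions and their ideals). [StacksProject]
* R. Hartshorne, *Algebraic Geometry*, GTM 52 (1977), II Ex. 3.11 (closed subschemes and their
  ideals) and II Prop. 5.2 (sections over affines). [Hartshorne1977]
-/

noncomputable section

universe u

open CategoryTheory AlgebraicGeometry Limits TopologicalSpace Opposite

namespace Literature.AlgebraicGeometry.Morphisms

variable {A B : Type u} [CommRing A] [CommRing B] (φ : A →+* B)
  {X Y : Scheme.{u}} (f : X ⟶ Spec (.of A)) {i : Y ⟶ X} {t : Y ⟶ Spec (.of B)}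

/-- **Functions from `ker φ` die on the base change**: if `i ≫ f = t ≫ Spec φ` then
`i♯(f♯(x)) = t♯((Spec φ)♯(x)) = 0` for `x ∈ ker φ` (global sections). [folklore] -/
theorem appTop_algebraMapΓ_eq_zero_of_mem_ker (w : i ≫ f = t ≫ Spec.map (CommRingCat.ofHom φ))
    {x : A} (hx : x ∈ RingHom.ker φ) : i.appTop (algebraMapΓ f x) = 0 := by
  change (f.appTop ≫ i.appTop) ((Scheme.ΓSpecIso (.of A)).inv x) = 0
  rw [← Scheme.Hom.comp_appTop, w, Scheme.Hom.comp_appTop]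
  change t.appTop (((Scheme.ΓSpecIso (.of A)).inv ≫ (Spec.map (CommRingCat.ofHom φ)).appTop) x) = 0
  rw [← Scheme.ΓSpecIso_inv_naturality]
  change t.appTop ((Scheme.ΓSpecIso (.of B)).inv (φ x)) = 0
  rw [RingHom.mem_ker.mp hx, map_zero, map_zero]

/-- Hence on every open `W ⊆ X`: `i♯_W` kills the image of `ker φ` in `Γ(X, W)` (the `A`-algebra
`Sections f W` of `Morphisms/CechH1.lean`). [folklore] -/
theorem app_algebraMap_eq_zero_of_mem_ker (w : i ≫ f = t ≫ Spec.map (CommRingCat.ofHom φ))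
    (W : X.Opens) {x : A} (hx : x ∈ RingHom.ker φ) :
    (i.app W).hom (algebraMap A (Sections f W) x) = 0 := by
  rw [Sections.algebraMap_apply]
  have h := congrArg (fun ψ => ψ.hom (algebraMapΓ f x))
    (i.naturality (homOfLE (le_top : W ≤ ⊤)).op)
  change (i.app W).hom (X.presheaf.map (homOfLE (le_top : W ≤ ⊤)).op (algebraMapΓ f x)) =
    Y.presheaf.map _ (i.appTop (algebraMapΓ f x)) at h
  rw [h, appTop_algebraMapΓ_eq_zero_of_mem_ker φ f w hx, map_zero]

/-- So the whole ideal `(ker φ) · Γ(X, W)` dies on `i⁻¹W`. [folklore] -/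
theorem app_eq_zero_of_mem_map_ker (w : i ≫ f = t ≫ Spec.map (CommRingCat.ofHom φ))
    (W : X.Opens) {b : Sections f W} (hb : b ∈ (RingHom.ker φ).map (algebraMap A (Sections f W))) :
    (i.app W).hom b = 0 := by
  let g : Sections f W →+* Γ(Y, i ⁻¹ᵁ W) := (i.app W).hom.comp (Sections.equiv f W).toRingHom
  have hle : (RingHom.ker φ).map (algebraMap A (Sections f W)) ≤ RingHom.ker g :=
    Ideal.map_le_iff_le_comap.mpr fun x hx =>
      RingHom.mem_ker.mpr (app_algebraMap_eq_zero_of_mem_ker φ f w W hx)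
  exact RingHom.mem_ker.mp (hle hb)

/-- **The kernel of restriction to an affine base change along a surjection** (`Γ(Y, i⁻¹W) =
Γ(X, W) ⊗_A B` for affine `W`): for a cartesian square `IsPullback i t f (Spec φ)` with `φ : A → B`
surjective and an affine open `W ⊆ X`, a function `b ∈ Γ(X, W)` with `i♯_W(b) = 0` lies in
`(ker φ) · Γ(X, W)`. [cite: StacksProject, Tag 02KG] -/
theorem mem_map_ker_of_app_eq_zero (hφ : Function.Surjective φ)
    (H : IsPullback i t f (Spec.map (CommRingCat.ofHom φ)))
    {W : X.Opens} (hW : IsAffineOpen W) (b : Sections f W) (hb : (i.app W).hom b = 0) :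
    b ∈ (RingHom.ker φ).map (algebraMap A (Sections f W)) := by
  -- the affine base-change square of sections
  have hsq := (isIso_pushoutSection_iff H (US := ⊤) (UT := ⊤) (UX := W)
    (UY := i ⁻¹ᵁ W ⊓ t ⁻¹ᵁ ⊤) le_top le_top rfl).mp
    (isIso_pushoutSection_of_isAffineOpen H le_top le_top rfl (isAffineOpen_top _)
      (isAffineOpen_top _) hW)
  -- the comparison maps to `Γ(X, W) / (ker φ) Γ(X, W)`
  set J : Ideal (Sections f W) := (RingHom.ker φ).map (algebraMap A (Sections f W)) with hJ
  let k₁ : Γ(X, W) ⟶ CommRingCat.of (Sections f W ⧸ J) := CommRingCat.ofHom (Ideal.Quotient.mk J)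
  have hI : RingHom.ker φ ≤ RingHom.ker ((Ideal.Quotient.mk J).comp (algebraMap A (Sections f W))) :=
    fun a ha ↦ Ideal.Quotient.eq_zero_iff_mem.mpr (Ideal.mem_map_of_mem _ ha)
  let ψ : B →+* Sections f W ⧸ J :=
    φ.liftOfSurjective hφ ⟨(Ideal.Quotient.mk J).comp (algebraMap A (Sections f W)), hI⟩
  have hψ : ∀ a : A, ψ (φ a) = Ideal.Quotient.mk J (algebraMap A (Sections f W) a) := fun a =>
    φ.liftOfSurjective_comp_apply hφ ⟨_, hI⟩ a
  let k₂ : Γ(Spec (.of B), ⊤) ⟶ CommRingCat.of (Sections f W ⧸ J) :=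
    (Scheme.ΓSpecIso (.of B)).hom ≫ CommRingCat.ofHom ψ
  have hcomm : f.appLE ⊤ W le_top ≫ k₁ =
      (Spec.map (CommRingCat.ofHom φ)).appLE ⊤ ⊤ le_top ≫ k₂ := by
    have epi : Epi (Scheme.ΓSpecIso (.of A)).inv := inferInstance
    rw [← cancel_epi (Scheme.ΓSpecIso (.of A)).inv]
    ext a
    change Ideal.Quotient.mk J ((f.app ⊤ ≫ X.presheaf.map (homOfLE _).op)
        ((Scheme.ΓSpecIso (.of A)).inv a)) =
      ψ ((Scheme.ΓSpecIso (.of B)).hom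
        (((Scheme.ΓSpecIso (.of A)).inv ≫ (Spec.map (CommRingCat.ofHom φ)).appLE ⊤ ⊤ le_top) a))
    have e2 : (Scheme.ΓSpecIso (.of A)).inv ≫ (Spec.map (CommRingCat.ofHom φ)).appLE ⊤ ⊤ le_top =
        CommRingCat.ofHom φ ≫ (Scheme.ΓSpecIso (.of B)).inv := by
      have h0 : (Spec.map (CommRingCat.ofHom φ)).appLE ⊤ ⊤ le_top =
          (Spec.map (CommRingCat.ofHom φ)).appTop :=
        (Scheme.Hom.app_eq_appLE _).symm
      rw [h0]
      exact (Scheme.ΓSpecIso_inv_naturality _).symm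
    rw [e2]
    change _ = ψ (((Scheme.ΓSpecIso (.of B)).inv ≫ (Scheme.ΓSpecIso _).hom) (φ a))
    rw [Iso.inv_hom_id]
    exact (hψ a).symm
  -- descend along the pushout and evaluate at `b`
  have hk : k₁ b = 0 := by
    have e1 : i.appLE W (i ⁻¹ᵁ W ⊓ t ⁻¹ᵁ ⊤) (by simp) ≫ hsq.desc k₁ k₂ hcomm = k₁ :=
      hsq.inl_desc k₁ k₂ hcomm
    rw [← e1]
    change hsq.desc k₁ k₂ hcomm ((i.app W ≫ Y.presheaf.map (homOfLE _).op) b) = 0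
    rw [CategoryTheory.comp_apply, hb, map_zero, map_zero]
  exact Ideal.Quotient.eq_zero_iff_mem.mp hk

/-- **Kernel = `(ker φ) Γ(X, W)`** on affine opens (both inclusions). [cite: StacksProject, Tag 02KG] -/
theorem app_eq_zero_iff_mem_map_ker (hφ : Function.Surjective φ)
    (H : IsPullback i t f (Spec.map (CommRingCat.ofHom φ)))
    {W : X.Opens} (hW : IsAffineOpen W) (b : Sections f W) :
    (i.app W).hom b = 0 ↔ b ∈ (RingHom.ker φ).map (algebraMap A (Sections f W)) :=
  ⟨mem_map_ker_of_app_eq_zero φ f hφ H hW b, app_eq_zero_of_mem_map_ker φ f H.w W⟩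

/-- **Principal case**: if `ker φ = (π)` then a function on an affine open `W` dying on `i⁻¹W` is
`π · c` for some `c ∈ Γ(X, W)`. [cite: StacksProject, Tag 02KG] -/
theorem exists_eq_smul_of_app_eq_zero (hφ : Function.Surjective φ) {π : A}
    (hker : RingHom.ker φ = Ideal.span {π})
    (H : IsPullback i t f (Spec.map (CommRingCat.ofHom φ)))
    {W : X.Opens} (hW : IsAffineOpen W) (b : Sections f W) (hb : (i.app W).hom b = 0) :
    ∃ c : Sections f W, b = π • c := by
  have h := mem_map_ker_of_app_eq_zero φ f hφ H hW b hb
  rw [hker, Ideal.map_span, Set.image_singleton, Ideal.mem_span_singleton'] at h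
  obtain ⟨c, rfl⟩ := h
  exact ⟨c, by rw [Algebra.smul_def, mul_comm]⟩

/-- The same, with the multiple written through the restriction of the global function
`f♯(π) ∈ Γ(X, 𝒪_X)` (the form `c = f♯(π)|_W · c'` consumed by
`Modules/PullbackClosedImmersionUnit.exact_globalScalar_pullbackUnit`). [folklore] -/
theorem exists_eq_mul_of_app_eq_zero (hφ : Function.Surjective φ) {π : A}
    (hker : RingHom.ker φ = Ideal.span {π})
    (H : IsPullback i t f (Spec.map (CommRingCat.ofHom φ)))
    {W : X.Opens} (hW : IsAffineOpen W) (b : Γ(X, W)) (hb : (i.app W).hom b = 0) :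
    ∃ c : Γ(X, W), b = X.presheaf.map (homOfLE (le_top : W ≤ ⊤)).op (algebraMapΓ f π) * c := by
  obtain ⟨c, hc⟩ := exists_eq_smul_of_app_eq_zero φ f hφ hker H hW b hb
  exact ⟨c, by rw [hc, Algebra.smul_def, Sections.algebraMap_apply]; rfl⟩

end Literature.AlgebraicGeometry.Morphisms

end
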